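import Mathlib.Analysis.SpecialFunctions.Pow.Real
import Mathlib.Tactic.Linarith
import Mathlib.Tactic.Positivity
import Mathlib.Tactic.FieldSimp
import Mathlib.Tactic.Ring
import HarnessLib

/-!
# `NoHeavyLowerTail` (stmt-CriticalPhenomena-4575) — the non-uniform reverse-Harris row APL: the one-step algebra and its
# closed-form recursion `K ↦ K/(1+16K²)`, `c(K) = 16K/(1+4K)²` (algebraic core)

Support file (prover seat `prim-cert-1`, gen 16; `--supports stmt-CriticalPhenomena-4575`; memo
`run/shared/lean/prim/prim-cert-1/FROM-prim-cert-1-g16-APL-NONUNIFORM.md`).  Pure real algebra, no definitions, no named facts,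
no sorries.

CONTEXT.  Cells of an apex `a` (or a sure-connected apex SET `S`) and targets `b, c` of a finite weighted graph: `u0 = P(a|b|c)`,
`uab = P(ab|c)`, `uac = P(ac|b)`, `e = uab + uac = P(a joined to exactly one of b,c)`, `D = P(b ↮ c) = u0 + e`,
`T = P(a ↔ b ∪ a ↔ c)`; the reverse-Harris row APL_Φ(κ) of the lineage (prim-ineq-gen-8 / prove-5; files `…APLTriRegime`,
`…APLLightTargets`, `…APLSwitching`) is `κ·D·T ≤ e`; Harris gives `e ≤ D·T`; conjecturally `κ = 2/3` uniformly.  prove-5 g37 (N)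
proved a NON-UNIFORM constant `c_n ≈ 1.4/√n` by eliminating the apex: conditioning on the open pairs at the apex gives sub-instances
`R` with `e = E e_R`, `T = E T_R`, `D = E D_R`, `D_R = σ − x_R` (`σ = P(b ↮ c off the apex)`), whence, if every sub-instance satisfies
APL_Φ(c₁),
  (h1)  `c₁·(D·T − y·(1−T)) ≤ e`,   `y = E x_R = P(b ↔ c, every b–c path meets the apex)`,
and the van den Berg–Häggström–Kahn slack  (h2)  `y·u0 ≤ uab·uac`.  This file is the ALGEBRA turning (h1)+(h2) into APL_Φ(c₂) with the
best constant this scheme allows: using `e/(D·T) = 1/((1+r)T)` (`r = u0/e`) the dichotomy parameter is chosen per instance, and the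
loss per elimination is `c₁c₂·T(1−T)/(4(1−c₂T))` instead of prove-5's `c₁/(4λ)`:
* `APL.disc_bound` — if `c₂(1+4K)² ≤ 16K` then `c₂·T(1−T) ≤ 4K(1−c₂T)` for every real `T`;
* `APL.nonuniform_step` — (h1), (h2), `1/c₁ + K ≤ 1/c₂`, `c₂(1+4K)² ≤ 16K` ⟹ `c₂·D·T ≤ e`;
* `APL.cK_recursion` — with `K' (1+16K²) = K`: `(1+4K')²/(16K') = (1+4K)²/(16K) + K'`, i.e. for `c(K) := 16K/(1+4K)²` one has
  `1/c(K') = 1/c(K) + K'` EXACTLY, so the constants of the induction are `c(K_m)`, `K_0 = 1/4` (`c = 1`), `K_{m+1} = K_m/(1+16K_m²)`: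
  `K_1 = 1/8 ↦ c = 8/9` (the V-shape value, sharp at three vertices), `K_2 = 1/10 ↦ 0.8163`, …, `c ≥ 3/10` up to 63 vertices,
  `c(K_m) ~ 2√2/√m`;
* `APL.cK_le_one`, `APL.cK_pos`, `APL.K_next_pos`, `APL.K_next_le` — bookkeeping (`0 < c(K) ≤ 1`, the recursion keeps `K ∈ (0, 1/4]`).
The measure-theoretic step and the induction are in the companion files `…APLNonuniformDecoupling` / `…APLNonuniform`.  [this work;
the scheme is prove-5 g37 (N), memo `run/shared/lean/prim/prim-ineq-prove-5/FROM-prim-ineq-prove-5-g37-APL-STRUCTURE.md` §3.5]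
-/

namespace Summit.CriticalPhenomena.PercolationContinuityZ3.Theorems

namespace APL

/-- **Discriminant bound.**  If `c₂(1+4K)² ≤ 16K` (and `c₂ ≥ 0`) then `c₂·T·(1−T) ≤ 4K·(1 − c₂T)` for every real `T`:
the quadratic `c₂T² − c₂(1+4K)T + 4K` has non-positive discriminant. [this work] -/
theorem disc_bound {c₂ K T : ℝ} (hc₂ : 0 ≤ c₂) (hdisc : c₂ * (1 + 4 * K) ^ 2 ≤ 16 * K) :
    c₂ * T * (1 - T) ≤ 4 * K * (1 - c₂ * T) := by
  have hsq : 0 ≤ c₂ * (T - (1 + 4 * K) / 2) ^ 2 := mul_nonneg hc₂ (sq_nonneg _)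
  nlinarith [hsq, hdisc]

/-- The one-step algebra in the two variables `u0` and `e = uab + uac` (with the BHK slack already combined with AM–GM:
`y·u0 ≤ e²/4`) and with the recursion hypothesis multiplied out (`c₂(1 + c₁K) ≤ c₁`). [this work] -/
theorem nonuniform_step_aux {u0 e T y c₁ c₂ K : ℝ} (h0 : 0 ≤ u0) (he : 0 ≤ e) (hT0 : 0 ≤ T) (hT1 : T ≤ 1)
    (hy : 0 ≤ y) (hc₁ : 0 < c₁) (hc₁1 : c₁ ≤ 1) (hc₂ : 0 < c₂) (hK : 0 < K)
    (hrec : c₂ * (1 + c₁ * K) ≤ c₁) (hdisc : c₂ * (1 + 4 * K) ^ 2 ≤ 16 * K)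
    (h1 : c₁ * ((u0 + e) * T - y * (1 - T)) ≤ e) (h2 : y * u0 ≤ e ^ 2 / 4) :
    c₂ * (u0 + e) * T ≤ e := by
  by_contra hcon
  push Not at hcon
  -- `hcon : e < c₂ (u0 + e) T`
  have hc₂lt1 : c₂ < 1 := by
    have : 0 < c₂ * (c₁ * K) := by positivity
    nlinarith
  have hTpos : 0 < T := by
    rcases hT0.eq_or_lt with h | h
    · exfalso; rw [← h] at hcon; simp at hcon; linarith
    · exact h
  have h1cT : 0 < 1 - c₂ * T := by
    have : c₂ * T ≤ c₂ := by nlinarith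
    linarith
  have h1T : 0 ≤ 1 - T := sub_nonneg.2 hT1
  -- `(u0+e) T (1 - c₂T) ≤ T u0`
  have hXu : (u0 + e) * T * (1 - c₂ * T) ≤ T * u0 := by
    have := mul_le_mul_of_nonneg_right hcon.le hT0
    nlinarith [this]
  have hA : (1 - T) * y * ((u0 + e) * T * (1 - c₂ * T)) ≤ (1 - T) * y * (T * u0) :=
    mul_le_mul_of_nonneg_left hXu (mul_nonneg h1T hy)
  have hB : (1 - T) * y * (T * u0) ≤ (1 - T) * T * (e ^ 2 / 4) := by
    have := mul_le_mul_of_nonneg_left h2 (mul_nonneg h1T hT0)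
    calc (1 - T) * y * (T * u0) = (1 - T) * T * (y * u0) := by ring
      _ ≤ (1 - T) * T * (e ^ 2 / 4) := this
  have hdb : c₂ * T * (1 - T) ≤ 4 * K * (1 - c₂ * T) := disc_bound hc₂.le hdisc
  have hC : c₂ * ((1 - T) * T * (e ^ 2 / 4)) ≤ K * (1 - c₂ * T) * e ^ 2 := by
    have := mul_le_mul_of_nonneg_right hdb (by positivity : (0:ℝ) ≤ e ^ 2 / 4)
    calc c₂ * ((1 - T) * T * (e ^ 2 / 4)) = c₂ * T * (1 - T) * (e ^ 2 / 4) := by ring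
      _ ≤ 4 * K * (1 - c₂ * T) * (e ^ 2 / 4) := this
      _ = K * (1 - c₂ * T) * e ^ 2 := by ring
  have hD : (1 - c₂ * T) * (c₂ * (1 - T) * y * ((u0 + e) * T)) ≤ (1 - c₂ * T) * (K * e ^ 2) := by
    have h' := mul_le_mul_of_nonneg_left (hA.trans hB) hc₂.le
    calc (1 - c₂ * T) * (c₂ * (1 - T) * y * ((u0 + e) * T))
        = c₂ * ((1 - T) * y * ((u0 + e) * T * (1 - c₂ * T))) := by ring
      _ ≤ c₂ * ((1 - T) * T * (e ^ 2 / 4)) := h'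
      _ ≤ K * (1 - c₂ * T) * e ^ 2 := hC
      _ = (1 - c₂ * T) * (K * e ^ 2) := by ring
  have hE : c₂ * (1 - T) * y * ((u0 + e) * T) ≤ K * e ^ 2 := le_of_mul_le_mul_left hD h1cT
  -- `e > 0`
  have hepos : 0 < e := by
    rcases he.eq_or_lt with h | h
    · exfalso
      rw [← h] at hcon h1 h2
      have hu0T : 0 < u0 * T := by nlinarith
      have hu0 : 0 < u0 := by
        rcases h0.eq_or_lt with h' | h'
        · rw [← h'] at hu0T; simp at hu0T
        · exact h'
      have hy0 : y = 0 := by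
        have : y * u0 ≤ 0 := by simpa using h2
        nlinarith
      rw [hy0] at h1
      have : c₁ * (u0 * T) ≤ 0 := by
        have h1' : c₁ * ((u0 + 0) * T - 0 * (1 - T)) ≤ 0 := h1
        simpa using h1'
      nlinarith [mul_pos hc₁ hu0T]
    · exact h
  have hF : (1 - T) * y * e ≤ K * e ^ 2 := by
    have := mul_le_mul_of_nonneg_left hcon.le (mul_nonneg h1T hy)
    calc (1 - T) * y * e ≤ (1 - T) * y * (c₂ * (u0 + e) * T) := this
      _ = c₂ * (1 - T) * y * ((u0 + e) * T) := by ring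
      _ ≤ K * e ^ 2 := hE
  have hG : (1 - T) * y ≤ K * e := by
    have : (1 - T) * y * e ≤ K * e * e := by
      calc (1 - T) * y * e ≤ K * e ^ 2 := hF
        _ = K * e * e := by ring
    exact le_of_mul_le_mul_right this hepos
  -- from (h1): `c₁ (u0+e) T ≤ e + c₁ (1-T) y ≤ e (1 + c₁ K)`
  have hH : c₁ * ((u0 + e) * T) ≤ e * (1 + c₁ * K) := by
    have expand : c₁ * ((u0 + e) * T - y * (1 - T)) = c₁ * ((u0 + e) * T) - c₁ * ((1 - T) * y) := by ring
    rw [expand] at h1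
    have := mul_le_mul_of_nonneg_left hG hc₁.le
    nlinarith [this, h1]
  have hI : c₁ * (c₂ * ((u0 + e) * T)) ≤ c₁ * e := by
    calc c₁ * (c₂ * ((u0 + e) * T)) = c₂ * (c₁ * ((u0 + e) * T)) := by ring
      _ ≤ c₂ * (e * (1 + c₁ * K)) := mul_le_mul_of_nonneg_left hH hc₂.le
      _ = e * (c₂ * (1 + c₁ * K)) := by ring
      _ ≤ e * c₁ := mul_le_mul_of_nonneg_left hrec he
      _ = c₁ * e := by ring
  have hJ : c₂ * ((u0 + e) * T) ≤ e := le_of_mul_le_mul_left hI hc₁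
  have : c₂ * (u0 + e) * T = c₂ * ((u0 + e) * T) := by ring
  linarith

/-- **The one-step algebra of the non-uniform APL induction.**  Cells `u0, uab, uac ≥ 0`, `e = uab + uac`, `D = u0 + e`,
`T ∈ [0,1]`, `y ≥ 0`; constants `0 < c₁ ≤ 1`, `0 < c₂`, `0 < K` with `1/c₁ + K ≤ 1/c₂` and `c₂(1+4K)² ≤ 16K`.  If
(h1) `c₁·(D·T − y·(1−T)) ≤ e` (every sub-instance after eliminating the apex satisfies APL_Φ(c₁)) and
(h2) `y·u0 ≤ uab·uac` (van den Berg–Häggström–Kahn slack), then APL_Φ(c₂): `c₂·D·T ≤ e`.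
Proof: if `c₂DT > e` then `T·u0 > DT(1−c₂T)`, so by (h2) and AM–GM `(1−T)·y ≤ (1−T)e²/(4u0) ≤ e·c₂T(1−T)/(4(1−c₂T)) ≤ K·e`
(`disc_bound`), and (h1) gives `c₁DT ≤ e(1+c₁K) ≤ e·c₁/c₂`, a contradiction. [this work] -/
theorem nonuniform_step {u0 uab uac T y c₁ c₂ K : ℝ} (h0 : 0 ≤ u0) (hab : 0 ≤ uab) (hac : 0 ≤ uac)
    (hT0 : 0 ≤ T) (hT1 : T ≤ 1) (hy : 0 ≤ y) (hc₁ : 0 < c₁) (hc₁1 : c₁ ≤ 1) (hc₂ : 0 < c₂) (hK : 0 < K)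
    (hrec : 1 / c₁ + K ≤ 1 / c₂) (hdisc : c₂ * (1 + 4 * K) ^ 2 ≤ 16 * K)
    (h1 : c₁ * ((u0 + uab + uac) * T - y * (1 - T)) ≤ uab + uac) (h2 : y * u0 ≤ uab * uac) :
    c₂ * (u0 + uab + uac) * T ≤ uab + uac := by
  -- the recursion hypothesis multiplied out: `c₂ (1 + c₁ K) ≤ c₁`
  have hrec' : c₂ * (1 + c₁ * K) ≤ c₁ := by
    have key : c₁ * c₂ * (1 / c₁ + K) = c₂ * (1 + c₁ * K) := by
      rw [mul_add, show c₁ * c₂ * (1 / c₁) = c₂ * (c₁ * (1 / c₁)) by ring, mul_one_div_cancel hc₁.ne']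
      ring
    have key2 : c₁ * c₂ * (1 / c₂) = c₁ := by
      rw [show c₁ * c₂ * (1 / c₂) = c₁ * (c₂ * (1 / c₂)) by ring, mul_one_div_cancel hc₂.ne', mul_one]
    calc c₂ * (1 + c₁ * K) = c₁ * c₂ * (1 / c₁ + K) := key.symm
      _ ≤ c₁ * c₂ * (1 / c₂) := mul_le_mul_of_nonneg_left hrec (by positivity)
      _ = c₁ := key2
  have hamgm : uab * uac ≤ (uab + uac) ^ 2 / 4 := by nlinarith [sq_nonneg (uab - uac)]
  have h2' : y * u0 ≤ (uab + uac) ^ 2 / 4 := h2.trans hamgm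
  have h1' : c₁ * ((u0 + (uab + uac)) * T - y * (1 - T)) ≤ uab + uac := by
    have : u0 + (uab + uac) = u0 + uab + uac := by ring
    rw [this]; exact h1
  have := nonuniform_step_aux h0 (by positivity : (0:ℝ) ≤ uab + uac) hT0 hT1 hy hc₁ hc₁1 hc₂ hK hrec' hdisc h1' h2'
  have e1 : c₂ * (u0 + uab + uac) * T = c₂ * (u0 + (uab + uac)) * T := by ring
  rw [e1]; exact this

/-- The recursion keeps `K` positive. [this work] -/
theorem K_next_pos {K K' : ℝ} (hK : 0 < K) (hK' : K' * (1 + 16 * K ^ 2) = K) : 0 < K' := by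
  have h16 : 0 < 1 + 16 * K ^ 2 := by positivity
  by_contra h; push Not at h
  have : K' * (1 + 16 * K ^ 2) ≤ 0 := mul_nonpos_of_nonpos_of_nonneg h h16.le
  linarith

/-- **The closed-form recursion.**  For `K > 0` and `K'·(1+16K²) = K` (i.e. `K' = K/(1+16K²)`):
`(1+4K)²/(16K) + K' = (1+4K')²/(16K')`; with `c(K) := 16K/(1+4K)²` this is `1/c(K) + K' = 1/c(K')`, the hypothesis `hrec` of
`nonuniform_step` with `c₁ = c(K)`, `c₂ = c(K')`, `K ← K'` (and `hdisc` holds with equality).  After cross-multiplication the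
identity is `16·(K'(1+16K²) − K) = 0`. [this work] -/
theorem cK_recursion {K K' : ℝ} (hK : 0 < K) (hK' : K' * (1 + 16 * K ^ 2) = K) :
    1 / (16 * K / (1 + 4 * K) ^ 2) + K' = 1 / (16 * K' / (1 + 4 * K') ^ 2) := by
  have hK'pos : 0 < K' := K_next_pos hK hK'
  rw [one_div_div, one_div_div, div_add' _ _ _ (by positivity : (16 * K : ℝ) ≠ 0),
    div_eq_div_iff (by positivity : (16 * K : ℝ) ≠ 0) (by positivity : (16 * K' : ℝ) ≠ 0)]
  linear_combination 16 * hK'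

/-- `c(K) = 16K/(1+4K)²` satisfies the discriminant condition of `nonuniform_step` with equality. [this work] -/
theorem cK_disc {K : ℝ} (hK : 0 < K) : 16 * K / (1 + 4 * K) ^ 2 * (1 + 4 * K) ^ 2 ≤ 16 * K := by
  have h1 : (1 + 4 * K) ^ 2 ≠ 0 := by positivity
  rw [div_mul_cancel₀ _ h1]

/-- `0 < c(K)` for `K > 0`. [this work] -/
theorem cK_pos {K : ℝ} (hK : 0 < K) : 0 < 16 * K / (1 + 4 * K) ^ 2 := by positivity

/-- `c(K) ≤ 1` (AM–GM: `16K ≤ (1+4K)²`). [this work] -/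
theorem cK_le_one {K : ℝ} (hK : 0 < K) : 16 * K / (1 + 4 * K) ^ 2 ≤ 1 := by
  rw [div_le_one (by positivity)]
  nlinarith [sq_nonneg (1 - 4 * K)]

/-- The recursion is non-increasing: `K' ≤ K`. [this work] -/
theorem K_next_le {K K' : ℝ} (hK : 0 < K) (hK' : K' * (1 + 16 * K ^ 2) = K) : K' ≤ K := by
  have hK'0 := K_next_pos hK hK'
  nlinarith [sq_nonneg K, mul_pos hK'0 hK]

/-- `c(1/4) = 1` and `c(1/8) = 8/9`: the first two constants (`K_0 = 1/4`, `K_1 = K_0/(1+16K_0²) = 1/8`); `8/9` is the exact value of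
`Φ = e/(DT)` on the V-shape `b – a – c` with both weights `1/2`. [this work] -/
theorem cK_first_values : 16 * (1/4 : ℝ) / (1 + 4 * (1/4)) ^ 2 = 1 ∧ (1/8 : ℝ) * (1 + 16 * (1/4) ^ 2) = 1/4 ∧
    16 * (1/8 : ℝ) / (1 + 4 * (1/8)) ^ 2 = 8/9 := by
  refine ⟨by norm_num, by norm_num, by norm_num⟩

end APL

end Summit.CriticalPhenomena.PercolationContinuityZ3.Theorems
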